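import Literature.AlgebraicGeometry.AbelianVarieties.MarkmanDescendedTransformCoh
import Literature.AlgebraicGeometry.Modules.DerivedPushforwardAmplitude
import Literature.AlgebraicGeometry.Modules.BoundedCoherentVBModels
import HarnessLib

/-!
# A bounded vector-bundle model of Markman's descended transform `E = R(pr_Y)_*(Ñ₀[0])` on the secant quotient
# (road (m-a′): Grothendieck coherence of higher direct images + strictly perfect models on a smooth projective variety)

Layer `Literature/AlgebraicGeometry/AbelianVarieties`; sequel to `MarkmanKernelTransformDescent` ((K3)+(K5)),
`MarkmanDescendedTransformCoh` (`Ñ₀` coherent, `E` is `≥ 0`), `Modules/DerivedPushforwardAmplitude` (`E` is `≤ N` by the ordered Čech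
model of a finite relatively-affine cover) and the two NAMED FACTS of `Modules/BoundedCoherentVBModels`:
[GS] `Grothendieck_higherDirectImage_coh` (EGA III 3.2.1) and [SP] `ThomasonTrobaugh_vbModel_of_boundedCoh` (TT 2.3.1 (d) + SGA 6 II 2.2.2.1).

* `isProper_secantQuotientFst` — `pr_Y : Y × A → Y` is proper (base change of `A → Spec ℂ`);
* `isLE_markmanDescendedTransform` — `E` is cohomologically bounded above (0 facts: ordered Čech model);
* **`markmanDescendedTransform_vbModel (hGS) (hSP) (hF₀ : Coh F₀) : ∃ E•, IsBoundedVBComplex E• ∧ Q⁺E• ≅ E`** — CONDITIONAL on the two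
  named facts (taken as hypotheses `hGS`, `hSP`; the gate records a conditional result).

0 new facts; no instances. Typed for the cell `pub-hodge-ring2` (the (m) MODEL of road №4's kernel leg); a research route conditional
on HC_CM, not a corollary — nothing in this file refers to it.

## References

* E. Markman, arXiv:2502.03415 (2025), §9.3 Remark 9.3.7 (p. 73). [Markman2025SecantWeil]
* A. Grothendieck, J. Dieudonné, EGA III (1961), Thm. 3.2.1. [EGAIII1]
* R. W. Thomason, T. Trobaugh (1990), Prop. 2.3.1 (d). [ThomasonTrobaugh1990]
-/

noncomputable section

-- `TopCat.Presheaf`/`Scheme.Modules` are not reducible (as in Mathlib's `AlgebraicGeometry/Modules/Sheaf.lean`).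
set_option backward.isDefEq.respectTransparency false

open CategoryTheory CategoryTheory.Limits AlgebraicGeometry MonoidalCategory CartesianMonoidalCategory
open AlgebraicGeometry.Scheme.Modules

universe v₄ v₅

namespace Literature.AlgebraicGeometry.AbelianVarieties

open Literature.AlgebraicGeometry.Motives Literature.AlgebraicGeometry.Modules Literature.AlgebraicGeometry.Markman2025
open Literature.AlgebraicGeometry.Morphisms Literature.AlgebraicGeometry.KTheory

variable (A : AbelianVariety ℂ) {Θ : CartierDivisor A.X.left} (hΘ : Θ.IsAmple) (hK : A.KTheta Θ = ⊥)
  {n : ℕ} (hn : n ≠ 0) (G₁ G₂ : Subgroup (A.Points ℂ)) (hG₁ : G₁ ≤ A.torsionPoints ℂ n) (hG₂ : G₂ ≤ A.torsionPoints ℂ n)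

/-- **`pr_Y : Y × A → Y` is proper** (it is the base change of the proper structure morphism `A → Spec ℂ` along `Y → Spec ℂ`).
[cite: Hartshorne1977, II Cor. 4.8 (c)] -/
theorem isProper_secantQuotientFst : IsProper (secantQuotientFst A hΘ hn G₁ G₂ hG₁ hG₂) :=
  inferInstanceAs (IsProper (pullback.fst (secantQuotient A hΘ G₁ G₂ hn hG₁ hG₂).X.hom A.X.hom))

variable [HasDerivedCategory.{v₄} ((secantQuotient A hΘ G₁ G₂ hn hG₁ hG₂).X ⊗ A.X).left.Modules]
  [HasDerivedCategory.{v₅} (secantQuotient A hΘ G₁ G₂ hn hG₁ hG₂).X.left.Modules]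

/-- **`E` is cohomologically bounded above**: `(markmanDescendedTransform …).IsLE N` for some `N` (0 facts: the ordered Čech model of
`R(pr_Y)_*` on a finite affine cover of the compact separated `Y × A`, whose faces are affine over the separated `Y`).
[cite: Hartshorne1977, III Ex. 8.2] [cite: StacksProject, Tag 01XD] -/
theorem isLE_markmanDescendedTransform {j : ℕ} (hj : 2 * j + 1 = n) (s m₁ m₂ : ℕ)
    (F₀ : ((A.torsionQuot hn G₁ hG₁).X ⊗ (A.torsionQuot hn G₂ hG₂).X).left.Modules) [F₀.IsQuasicoherent] :
    ∃ N : ℤ, (markmanDescendedTransform A hΘ hK hn G₁ G₂ hG₁ hG₂ hj s m₁ m₂ F₀).IsLE N := by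
  let Y := secantQuotient A hΘ G₁ G₂ hn hG₁ hG₂
  haveI : CompactSpace ↑((secantQuotient A hΘ G₁ G₂ hn hG₁ hG₂).X ⊗ A.X).left := AbelianVariety.compactSpace_left (Y.prod A)
  haveI : ((secantQuotient A hΘ G₁ G₂ hn hG₁ hG₂).X ⊗ A.X).left.IsSeparated := AbelianVariety.isSeparated_left (Y.prod A)
  haveI := AbelianVariety.isSeparated_left Y
  obtain ⟨ι, hι, U, hU, hUaff⟩ := exists_finite_cover_faces_affineHom (secantQuotientFst A hΘ hn G₁ G₂ hG₁ hG₂)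
  letI : Fintype ι := Fintype.ofFinite ι
  letI : LinearOrder ι := LinearOrder.lift' (Fintype.equivFin ι) (Fintype.equivFin ι).injective
  exact ⟨_, isLE_derivedPushforwardPlus_single (secantQuotientFst A hΘ hn G₁ G₂ hG₁ hG₂) U hU hUaff
    (isAffineLocalizing_markmanDescendedInput A hΘ hK hn G₁ G₂ hG₁ hG₂ hj s m₁ m₂ F₀)⟩

/-- **THE (m) MODEL: a bounded complex of finite locally free `𝒪_Y`-modules `E•` with `Q⁺(E•) ≅ E = R(pr_Y)_*(Ñ₀[0])`**, for `F₀`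
coherent — CONDITIONAL on [GS] (`Grothendieck_higherDirectImage_coh`: the cohomology sheaves of `E` are coherent, `pr_Y` being proper
and `Ñ₀` coherent) and [SP] (`ThomasonTrobaugh_vbModel_of_boundedCoh`: bounded coherent objects of `D⁺(Mod 𝒪_Y)` on the complex
abelian variety `Y` are classes of bounded vector-bundle complexes); amplitude `[0, N]` is proved (0 facts).
[cite: Markman2025SecantWeil, §9.3 Remark 9.3.7 (p. 73)] [cite: EGAIII1, Thm. 3.2.1] [cite: ThomasonTrobaugh1990, Prop. 2.3.1 (d)] -/
theorem markmanDescendedTransform_vbModel (hGS : Grothendieck_higherDirectImage_coh.{0, v₄, v₅})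
    (hSP : ThomasonTrobaugh_vbModel_of_boundedCoh.{v₅}) {j : ℕ} (hj : 2 * j + 1 = n) (s m₁ m₂ : ℕ)
    (F₀ : ((A.torsionQuot hn G₁ hG₁).X ⊗ (A.torsionQuot hn G₂ hG₂).X).left.Modules) (hF₀ : Coh F₀) :
    ∃ (K : CochainComplex (secantQuotient A hΘ G₁ G₂ hn hG₁ hG₂).X.left.Modules ℤ) (_ : IsBoundedVBComplex K)
      (n₀ : ℤ) (hn₀ : CochainComplex.IsStrictlyGE K n₀),
      Nonempty (DerivedCategory.Plus.Q.obj ⟨K, n₀, hn₀⟩ ≅ markmanDescendedTransform A hΘ hK hn G₁ G₂ hG₁ hG₂ hj s m₁ m₂ F₀) := by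
  haveI : F₀.IsQuasicoherent := isQuasicoherent_of_isAffineLocalizing hF₀.loc
  haveI := isProper_secantQuotientFst A hΘ hn G₁ G₂ hG₁ hG₂
  obtain ⟨N, hN⟩ := isLE_markmanDescendedTransform A hΘ hK hn G₁ G₂ hG₁ hG₂ hj s m₁ m₂ F₀
  haveI := isGE_zero_markmanDescendedTransform A hΘ hK hn G₁ G₂ hG₁ hG₂ hj s m₁ m₂ F₀
  exact hSP (secantQuotient A hΘ G₁ G₂ hn hG₁ hG₂) _ 0 N inferInstance hN fun k =>
    hGS (secantQuotientFst A hΘ hn G₁ G₂ hG₁ hG₂) _ (coh_markmanDescendedInput A hΘ hK hn G₁ G₂ hG₁ hG₂ hj s m₁ m₂ F₀ hF₀) k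

end Literature.AlgebraicGeometry.AbelianVarieties

end
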